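import Summits.KontsevichZagierPeriods.KontsevichZagierPeriods.Theorems.LinRedNormalFormArrangementNormalFormStubRebaseSimplePosOneFibreThick

/-!
# Stub `stub_rebaseSimplePosOne` (crux `ArrangementNormalForm`, line `janus-bands`, v6.2) —
part `Corner`: isolating the corner residue of the one-fibre rebase

For the two residual hypotheses `Hthick` (`κ < 0 < u < v`) and `Hfar` (`0 < κ`, `v ≥ 2κ`) of
`RebasePos.good_above_of_residual` (one lettered fibre over a base of dimension `B + 1`, letter
`0`, transverse bounds `u < v` above their apex level `κ`: `u − κ = A (v − u)`, `A > 0`), a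
COMPACTNESS DICHOTOMY: either the closed base cell `{rows ≥ 0}` contains a CORNER POINT, where
the apex of the band lies on the letter (`κ = u = v = 0`), or the band is thick (`v − u ≥ c₀ > 0`
on the base cell, `RebasePos.exists_pos_le_affF` = extreme value theorem on the compact closed
cell) and `rebaseSimplePos_thickBand` closes it (`RebasePos.good_thick_of_noCorner`,
`RebasePos.good_far_of_noCorner`). Hence the one-fibre rebase holds as soon as parallel bands
(`Hpar`) and CORNER bands (`Hthick`/`Hfar` for cells whose closed cell contains a corner point)
are congruent to the subgroup generated by `GG B 2 1`: `RebasePos.good_above_of_corner`,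
registered as `rebaseSimplePos_oneFibre_of_corner`.

The corner residue is genuine for the implemented moves (base cuts, fibre cuts at affine levels,
Janus extensions to `y`-free levels with fibrewise dominated wedges, per-fibre affine pull-backs,
coaxial blow-ups): for the absolutely convergent member
`[{0 < x < y < 1, y − x < t < 2y − x}, 1/(y t)]` (`B = 1`, `κ = −x`, `A = 1`, `v − u = y`,
corner `(0, 0)`; mass `∫₀¹∫₀¹ log((2 − s)/(1 − s)) ds dy < ∞`) no `y`-free level lies below `u`
and above the letter (`inf u = 0`) or between the bounds (`sup u = 1 > 0 = inf v` near the
corner), the pinch is not coaxial (`κ ≠ 0`), and the upper Janus wedge `{2y − x < t < K}` has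
fibre mass `log (K/(2y − x)) → ∞` against band mass `→ log 3` along `y = 2x → 0`, so it is not
fibrewise dominated by the band (it does converge, by the power-log asymptotics of the mass of
the base factor near the corner — an argument outside the toolbox).

References: M. Kontsevich, D. Zagier, *Periods* (2001), §1.2, rules (1a), (2).
-/

noncomputable section

open Set MeasureTheory MvPolynomial
open Literature.NumberTheory.Transcendental Literature.ModelTheory.ExponentialFields

namespace Summit.KontsevichZagierPeriods.ArrangementNormalForm.JanusBands

namespace RebasePos

open SeparatePos

section Corner

variable {B m m' : ℕ}

/-- Full-base affine forms are continuous. -/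
theorem continuous_affF (d : (Fin (B + 1) → ℚ) × ℚ) :
    Continuous fun z : Fin (B + 1 + 1) → ℝ => affF B 1 d z := by
  unfold affF
  fun_prop

/-- Non-strict rows of an extended row family. -/
theorem rows_snoc_le_iff {M : Fin m' → (Fin (B + 1) → ℚ) × ℚ} {h : (Fin (B + 1) → ℚ) × ℚ}
    {z : Fin (B + 1 + 1) → ℝ} :
    (∀ j, 0 ≤ affF B 1 ((Fin.snoc M h : Fin (m' + 1) → _) j) z) ↔
      (∀ j, 0 ≤ affF B 1 (M j) z) ∧ 0 ≤ affF B 1 h z := by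
  simp only [Fin.forall_fin_succ', Fin.snoc_castSucc, Fin.snoc_last]

/-- **Extreme value theorem on a closed cell.** If the affine form `φ` is positive at every
point of the closed cell `{∀ i, 0 ≤ Nᵢ}` with base coordinates bounded by `R`, it is bounded
below there by a positive constant (the closed cell, normalised to `t = 0`, is compact). -/
theorem exists_pos_le_affF {k : ℕ} (N : Fin k → (Fin (B + 1) → ℚ) × ℚ) (R : ℝ)
    (φ : (Fin (B + 1) → ℚ) × ℚ)
    (hpos : ∀ z : Fin (B + 1 + 1) → ℝ, (∀ i, 0 ≤ affF B 1 (N i) z) →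
      (∀ j : Fin (B + 1), |z (Fin.castAdd 1 j)| ≤ R) → 0 < affF B 1 φ z) :
    ∃ c₀ : ℝ, 0 < c₀ ∧ ∀ z : Fin (B + 1 + 1) → ℝ, (∀ i, 0 ≤ affF B 1 (N i) z) →
      (∀ j : Fin (B + 1), |z (Fin.castAdd 1 j)| ≤ R) → c₀ ≤ affF B 1 φ z := by
  set Q : Set (Fin (B + 1 + 1) → ℝ) := {z | (∀ i, 0 ≤ affF B 1 (N i) z) ∧
    (∀ j : Fin (B + 1), |z (Fin.castAdd 1 j)| ≤ R) ∧ z (tI B) = 0} with hQ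
  -- normalisation `t := 0`
  have hnorm : ∀ z : Fin (B + 1 + 1) → ℝ, (∀ i, 0 ≤ affF B 1 (N i) z) →
      (∀ j : Fin (B + 1), |z (Fin.castAdd 1 j)| ≤ R) → Function.update z (tI B) 0 ∈ Q :=
    fun z hN hR => by
      rw [hQ, mem_setOf_eq]
      exact ⟨fun i => by rw [affF_update_tI]; exact hN i,
        fun j => by rw [Function.update_of_ne (castAdd_ne_tI j)]; exact hR j,
        Function.update_self _ _ _⟩
  have hclosed : IsClosed Q := by
    rw [hQ]
    simp only [setOf_and, setOf_forall]
    exact (isClosed_iInter fun i => isClosed_le continuous_const (continuous_affF (N i))).inter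
      ((isClosed_iInter fun j => isClosed_le ((continuous_apply _).abs) continuous_const).inter
        (isClosed_eq (continuous_apply _) continuous_const))
  have hbdd : Bornology.IsBounded Q := isBounded_of_forall_abs_le (max R 0) fun z hz l => by
    rw [hQ, mem_setOf_eq] at hz
    obtain ⟨-, hR, ht⟩ := hz
    refine Fin.addCases (fun j => (hR j).trans (le_max_left _ _)) (fun i => ?_) l
    rw [show Fin.natAdd (B + 1) i = tI B by rw [Subsingleton.elim i 0], ht, abs_zero]
    exact le_max_right _ _
  have hcpt : IsCompact Q := Metric.isCompact_of_isClosed_isBounded hclosed hbdd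
  rcases Q.eq_empty_or_nonempty with hemp | hne
  · refine ⟨1, one_pos, fun z hN hR => ?_⟩
    have h := hnorm z hN hR
    rw [hemp] at h
    exact absurd h (notMem_empty _)
  · obtain ⟨z₀, hz₀, hmin⟩ := hcpt.exists_isMinOn hne (continuous_affF φ).continuousOn
    have hz₀' := hz₀
    rw [hQ, mem_setOf_eq] at hz₀'
    refine ⟨affF B 1 φ z₀, hpos z₀ hz₀'.1 hz₀'.2.1, fun z hN hR => ?_⟩
    have h := isMinOn_iff.1 hmin _ (hnorm z hN hR)
    rwa [affF_update_tI] at h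

variable (L : Fin m → (Fin B → ℚ) × ℚ) (e : Fin m → ℕ) (ℓ₁ ℓ₂ : (Fin B → ℚ) × ℚ) (n₁ n₂ : ℕ)

/-- **`Hthick` without corner.** A band above its apex level `κ` with the apex level below the
letter (`κ < 0 < u < v`, `u − κ = A (v − u)`, `A > 0`) whose CLOSED base cell `{rows ≥ 0}`
contains no corner point (`κ = u = v = 0`) is thick (`v − u ≥ c₀ > 0` on the base cell, by
compactness: on the closed cell `v − u = (u − κ)/A ≥ 0` with equality only at a corner point),
hence congruent to the subgroup generated by `GG B 2 1` (`good_thickBand`). -/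
theorem good_thick_of_noCorner (s : KZ.IntegralRep (B + 1 + 1)) (M : Fin m' → (Fin (B + 1) → ℚ) × ℚ)
    (p : MvPolynomial (Fin B) ℚ) (u v κ : (Fin (B + 1) → ℚ) × ℚ) (A : ℚ)
    (h12 : n₁ = 0 ∨ n₂ = 0) (hbd : Bornology.IsBounded s.domain)
    (hdom : s.domain = gDom B 1 m' M (fun _ => Sum.inr u) (fun _ => Sum.inr v))
    (hint : EqOn s.integrand (glit B 1 p L e ℓ₁ ℓ₂ n₁ n₂ (fun _ => some 0)) s.domain)
    (hA : u - κ = A • (v - u)) (hA0 : 0 < A)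
    (hcell : ∀ z : Fin (B + 1 + 1) → ℝ, (∀ j, 0 < affF B 1 (M j) z) →
      affF B 1 κ z < 0 ∧ 0 < affF B 1 u z ∧ affF B 1 u z < affF B 1 v z)
    (hnc : ∀ z : Fin (B + 1 + 1) → ℝ, (∀ j, 0 ≤ affF B 1 (M j) z) →
      affF B 1 κ z = 0 → affF B 1 u z = 0 → affF B 1 v z = 0 → False) :
    ∃ c ∈ AddSubgroup.closure (GGset B 2 1), KZ.of s - c ∈ KZ.relations := by
  have huκ : ∀ z : Fin (B + 1 + 1) → ℝ, affF B 1 u z - affF B 1 κ z =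
      (A : ℝ) * (affF B 1 v z - affF B 1 u z) := fun z => by
    have key := congrArg (fun q => affF B 1 q z) hA
    simp only [affF_sub'', affF_smul'] at key
    exact key
  have hA0' : (0 : ℝ) < A := by exact_mod_cast hA0
  obtain ⟨R, -, hR⟩ := exists_base_abs_le M u v (hdom ▸ hbd) fun z hz => (hcell z hz).2.2
  -- thickness on the closed cell `{rows ≥ 0, -κ ≥ 0, u ≥ 0}`
  obtain ⟨c₀, hc₀, hge⟩ := exists_pos_le_affF
    (Fin.snoc (Fin.snoc M (-κ) : Fin (m' + 1) → _) u : Fin (m' + 1 + 1) → _) R (v - u)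
    fun z hN _ => by
      rw [rows_snoc_le_iff, rows_snoc_le_iff, affF_neg'] at hN
      obtain ⟨⟨hrow, hκ0⟩, hu0⟩ := hN
      rw [affF_sub'']
      by_contra hφ
      push Not at hφ
      have h1 := huκ z
      have hφ0 : affF B 1 v z - affF B 1 u z = 0 := by nlinarith
      rw [hφ0, mul_zero] at h1
      have hu : affF B 1 u z = 0 := by linarith
      exact hnc z hrow (by linarith) hu (by linarith)
  refine good_thickBand L e ℓ₁ ℓ₂ n₁ n₂ s M p u v c₀ h12 hbd hdom hint hc₀ fun z hz => ?_
  obtain ⟨hκ, hu, -⟩ := hcell z hz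
  have h := hge z (by
    rw [rows_snoc_le_iff, rows_snoc_le_iff, affF_neg']
    exact ⟨⟨fun j => (hz j).le, by linarith⟩, hu.le⟩) (hR z hz)
  rw [affF_sub''] at h
  exact ⟨hu, by linarith⟩

/-- **`Hfar` without corner.** A band above its apex level `κ > 0` in the far regime `v ≥ 2κ`
(`u − κ = A (v − u)`, `A > 0`) whose closed base cell contains no corner point (`κ = u = v = 0`)
is thick (on the closed cell `v − u = (v − κ)/(A + 1) ≥ κ/(A + 1) ≥ 0` with equality only at a
corner point), hence congruent to the subgroup generated by `GG B 2 1` (`good_thickBand`). -/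
theorem good_far_of_noCorner (s : KZ.IntegralRep (B + 1 + 1)) (M : Fin m' → (Fin (B + 1) → ℚ) × ℚ)
    (p : MvPolynomial (Fin B) ℚ) (u v κ : (Fin (B + 1) → ℚ) × ℚ) (A : ℚ)
    (h12 : n₁ = 0 ∨ n₂ = 0) (hbd : Bornology.IsBounded s.domain)
    (hdom : s.domain = gDom B 1 m' M (fun _ => Sum.inr u) (fun _ => Sum.inr v))
    (hint : EqOn s.integrand (glit B 1 p L e ℓ₁ ℓ₂ n₁ n₂ (fun _ => some 0)) s.domain)
    (hA : u - κ = A • (v - u)) (hA0 : 0 < A)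
    (hcell : ∀ z : Fin (B + 1 + 1) → ℝ, (∀ j, 0 < affF B 1 (M j) z) →
      0 < affF B 1 κ z ∧ affF B 1 u z < affF B 1 v z ∧ 2 * affF B 1 κ z ≤ affF B 1 v z)
    (hnc : ∀ z : Fin (B + 1 + 1) → ℝ, (∀ j, 0 ≤ affF B 1 (M j) z) →
      affF B 1 κ z = 0 → affF B 1 u z = 0 → affF B 1 v z = 0 → False) :
    ∃ c ∈ AddSubgroup.closure (GGset B 2 1), KZ.of s - c ∈ KZ.relations := by
  have huκ : ∀ z : Fin (B + 1 + 1) → ℝ, affF B 1 u z - affF B 1 κ z =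
      (A : ℝ) * (affF B 1 v z - affF B 1 u z) := fun z => by
    have key := congrArg (fun q => affF B 1 q z) hA
    simp only [affF_sub'', affF_smul'] at key
    exact key
  have hA0' : (0 : ℝ) < A := by exact_mod_cast hA0
  have h2κ : ∀ z : Fin (B + 1 + 1) → ℝ, affF B 1 (v - (2 : ℚ) • κ) z = affF B 1 v z - 2 * affF B 1 κ z :=
    fun z => by rw [affF_sub'', affF_smul']; push_cast; ring
  obtain ⟨R, -, hR⟩ := exists_base_abs_le M u v (hdom ▸ hbd) fun z hz => (hcell z hz).2.1
  -- thickness on the closed cell `{rows ≥ 0, κ ≥ 0, v - 2κ ≥ 0}`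
  obtain ⟨c₀, hc₀, hge⟩ := exists_pos_le_affF
    (Fin.snoc (Fin.snoc M κ : Fin (m' + 1) → _) (v - (2 : ℚ) • κ) : Fin (m' + 1 + 1) → _) R (v - u)
    fun z hN _ => by
      rw [rows_snoc_le_iff, rows_snoc_le_iff, h2κ] at hN
      obtain ⟨⟨hrow, hκ0⟩, hfar⟩ := hN
      rw [affF_sub'']
      by_contra hφ
      push Not at hφ
      have h1 := huκ z
      have hφ0 : affF B 1 v z - affF B 1 u z = 0 := by nlinarith
      have hκ : affF B 1 κ z = 0 := by nlinarith
      exact hnc z hrow hκ (by nlinarith) (by nlinarith)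
  refine good_thickBand L e ℓ₁ ℓ₂ n₁ n₂ s M p u v c₀ h12 hbd hdom hint hc₀ fun z hz => ?_
  obtain ⟨hκ, huv, hfar⟩ := hcell z hz
  have h := hge z (by
    rw [rows_snoc_le_iff, rows_snoc_le_iff, h2κ]
    exact ⟨⟨fun j => (hz j).le, hκ.le⟩, by linarith⟩) (hR z hz)
  rw [affF_sub''] at h
  refine ⟨?_, by linarith⟩
  nlinarith [huκ z]

/-- **A band above its letter, from parallel bands and corner bands.** As
`good_above_of_residual`, but the residual hypotheses `Hthick` / `Hfar` are only required for
base cells whose CLOSED cell `{rows ≥ 0}` contains a corner point (`κ = u = v = 0`: the apex of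
the band on the letter); cells without corner are thick (`good_thick_of_noCorner`,
`good_far_of_noCorner`). -/
theorem good_above_of_corner (s : KZ.IntegralRep (B + 1 + 1)) (M : Fin m' → (Fin (B + 1) → ℚ) × ℚ)
    (p : MvPolynomial (Fin B) ℚ) (u v : (Fin (B + 1) → ℚ) × ℚ) (h12 : n₁ = 0 ∨ n₂ = 0)
    (hbd : Bornology.IsBounded s.domain)
    (hdom : s.domain = gDom B 1 m' M (fun _ => Sum.inr u) (fun _ => Sum.inr v))
    (hint : EqOn s.integrand (glit B 1 p L e ℓ₁ ℓ₂ n₁ n₂ (fun _ => some 0)) s.domain)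
    (hu : u.1 (Fin.last B) ≠ 0) (hv : v.1 (Fin.last B) ≠ 0)
    (hcell : ∀ z : Fin (B + 1 + 1) → ℝ, (∀ j, 0 < affF B 1 (M j) z) →
      0 < affF B 1 u z ∧ affF B 1 u z < affF B 1 v z)
    (Hpar : ∀ (m' : ℕ) (s : KZ.IntegralRep (B + 1 + 1)) (M : Fin m' → (Fin (B + 1) → ℚ) × ℚ)
      (p : MvPolynomial (Fin B) ℚ) (u v : (Fin (B + 1) → ℚ) × ℚ), Bornology.IsBounded s.domain →
      s.domain = gDom B 1 m' M (fun _ => Sum.inr u) (fun _ => Sum.inr v) →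
      EqOn s.integrand (glit B 1 p L e ℓ₁ ℓ₂ n₁ n₂ (fun _ => some 0)) s.domain →
      u.1 (Fin.last B) ≠ 0 → u.1 (Fin.last B) = v.1 (Fin.last B) →
      (∀ z : Fin (B + 1 + 1) → ℝ, (∀ j, 0 < affF B 1 (M j) z) → 0 < affF B 1 u z ∧ affF B 1 u z < affF B 1 v z) →
      ∃ c ∈ AddSubgroup.closure (GGset B 2 1), KZ.of s - c ∈ KZ.relations)
    (Hthick : ∀ (m' : ℕ) (s : KZ.IntegralRep (B + 1 + 1)) (M : Fin m' → (Fin (B + 1) → ℚ) × ℚ)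
      (p : MvPolynomial (Fin B) ℚ) (u v κ : (Fin (B + 1) → ℚ) × ℚ) (A : ℚ), Bornology.IsBounded s.domain →
      s.domain = gDom B 1 m' M (fun _ => Sum.inr u) (fun _ => Sum.inr v) →
      EqOn s.integrand (glit B 1 p L e ℓ₁ ℓ₂ n₁ n₂ (fun _ => some 0)) s.domain →
      κ.1 (Fin.last B) = 0 → u - κ = A • (v - u) → 0 < A →
      (∀ z : Fin (B + 1 + 1) → ℝ, (∀ j, 0 < affF B 1 (M j) z) →
        affF B 1 κ z < 0 ∧ 0 < affF B 1 u z ∧ affF B 1 u z < affF B 1 v z) →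
      (∃ z : Fin (B + 1 + 1) → ℝ, (∀ j, 0 ≤ affF B 1 (M j) z) ∧
        affF B 1 κ z = 0 ∧ affF B 1 u z = 0 ∧ affF B 1 v z = 0) →
      ∃ c ∈ AddSubgroup.closure (GGset B 2 1), KZ.of s - c ∈ KZ.relations)
    (Hfar : ∀ (m' : ℕ) (s : KZ.IntegralRep (B + 1 + 1)) (M : Fin m' → (Fin (B + 1) → ℚ) × ℚ)
      (p : MvPolynomial (Fin B) ℚ) (u v κ : (Fin (B + 1) → ℚ) × ℚ) (A : ℚ), Bornology.IsBounded s.domain →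
      s.domain = gDom B 1 m' M (fun _ => Sum.inr u) (fun _ => Sum.inr v) →
      EqOn s.integrand (glit B 1 p L e ℓ₁ ℓ₂ n₁ n₂ (fun _ => some 0)) s.domain →
      κ.1 (Fin.last B) = 0 → u - κ = A • (v - u) → 0 < A →
      (∀ z : Fin (B + 1 + 1) → ℝ, (∀ j, 0 < affF B 1 (M j) z) →
        0 < affF B 1 κ z ∧ affF B 1 u z < affF B 1 v z ∧ 2 * affF B 1 κ z ≤ affF B 1 v z) →
      (∃ z : Fin (B + 1 + 1) → ℝ, (∀ j, 0 ≤ affF B 1 (M j) z) ∧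
        affF B 1 κ z = 0 ∧ affF B 1 u z = 0 ∧ affF B 1 v z = 0) →
      ∃ c ∈ AddSubgroup.closure (GGset B 2 1), KZ.of s - c ∈ KZ.relations) :
    ∃ c ∈ AddSubgroup.closure (GGset B 2 1), KZ.of s - c ∈ KZ.relations := by
  refine good_above_of_residual L e ℓ₁ ℓ₂ n₁ n₂ s M p u v h12 hbd hdom hint hu hv hcell Hpar
    (fun m' s M p u v κ A hbd hdom hint hκ hA hA0 hcell => ?_)
    (fun m' s M p u v κ A hbd hdom hint hκ hA hA0 hcell => ?_)
  · by_cases hc : ∃ z : Fin (B + 1 + 1) → ℝ, (∀ j, 0 ≤ affF B 1 (M j) z) ∧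
        affF B 1 κ z = 0 ∧ affF B 1 u z = 0 ∧ affF B 1 v z = 0
    · exact Hthick m' s M p u v κ A hbd hdom hint hκ hA hA0 hcell hc
    · push Not at hc
      exact good_thick_of_noCorner L e ℓ₁ ℓ₂ n₁ n₂ s M p u v κ A h12 hbd hdom hint hA hA0 hcell
        fun z h1 h2 h3 h4 => hc z h1 h2 h3 h4
  · by_cases hc : ∃ z : Fin (B + 1 + 1) → ℝ, (∀ j, 0 ≤ affF B 1 (M j) z) ∧
        affF B 1 κ z = 0 ∧ affF B 1 u z = 0 ∧ affF B 1 v z = 0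
    · exact Hfar m' s M p u v κ A hbd hdom hint hκ hA hA0 hcell hc
    · push Not at hc
      exact good_far_of_noCorner L e ℓ₁ ℓ₂ n₁ n₂ s M p u v κ A h12 hbd hdom hint hA hA0 hcell
        fun z h1 h2 h3 h4 => hc z h1 h2 h3 h4

end Corner

end RebasePos

/-- **Registered part of `stub_rebaseSimplePosOne` / `rebaseSimplePos_oneFibre` (line
`janus-bands`, v6.2): the one-fibre rebase from parallel bands and corner bands.** For literal
one-fibre data over a base of dimension `B + 1` (any bounds, any letter, `n₁ = 0 ∨ n₂ = 0`): IF
parallel transverse bands (`Hpar`) and the CORNER bands — bands above their apex level `κ`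
(`u − κ = A (v − u)`, `A > 0`, `κ` parallel in `y` to the letter `0`) with the apex level below the
letter (`Hthick`) or in the far regime `v ≥ 2κ > 0` (`Hfar`), WHOSE CLOSED BASE CELL
`{rows ≥ 0}` CONTAINS A CORNER POINT `κ = u = v = 0` (apex on the letter) — are congruent to the
subgroup generated by `GG B 2 1`, THEN so is `[s]`: `rebaseSimplePos_oneFibre_of_residual` plus
the compactness dichotomy of `RebasePos.good_thick_of_noCorner` / `good_far_of_noCorner`
(cells without corner are thick bands, `rebaseSimplePos_thickBand`). The corner bands are the
exact residue of the one-fibre rebase within the implemented moves (see the module docstring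
for a member and the obstruction). -/
theorem rebaseSimplePos_oneFibre_of_corner (B m m' n₁ n₂ : ℕ) (s : KZ.IntegralRep (B + 1 + 1)) (M : Fin m' → (Fin (B + 1) → ℚ) × ℚ) (L : Fin m → (Fin B → ℚ) × ℚ) (e : Fin m → ℕ) (p : MvPolynomial (Fin B) ℚ) (ℓ₁ ℓ₂ : (Fin B → ℚ) × ℚ) (a : Fin 1 → Option ((Fin (B + 1) → ℚ) × ℚ)) (lo hi : Fin 1 → Fin 1 ⊕ ((Fin (B + 1) → ℚ) × ℚ)) (h12 : n₁ = 0 ∨ n₂ = 0) (hbd : Bornology.IsBounded s.domain) (hdom : s.domain = SeparatePos.gDom B 1 m' M lo hi) (hint : EqOn s.integrand (RebasePos.glit B 1 p L e ℓ₁ ℓ₂ n₁ n₂ a) s.domain) (Hpar : ∀ (m' : ℕ) (s : KZ.IntegralRep (B + 1 + 1)) (M : Fin m' → (Fin (B + 1) → ℚ) × ℚ) (p : MvPolynomial (Fin B) ℚ) (u v : (Fin (B + 1) → ℚ) × ℚ), Bornology.IsBounded s.domain → s.domain = SeparatePos.gDom B 1 m' M (fun _ => Sum.inr u) (fun _ =>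 Sum.inr v) → EqOn s.integrand (RebasePos.glit B 1 p L e ℓ₁ ℓ₂ n₁ n₂ (fun _ => some 0)) s.domain → u.1 (Fin.last B) ≠ 0 → u.1 (Fin.last B) = v.1 (Fin.last B) → (∀ z : Fin (B + 1 + 1) → ℝ, (∀ j, 0 < SeparatePos.affF B 1 (M j) z) → 0 < SeparatePos.affF B 1 u z ∧ SeparatePos.affF B 1 u z < SeparatePos.affF B 1 v z) → ∃ c ∈ AddSubgroup.closure (SeparatePos.GGset B 2 1), KZ.of s - c ∈ KZ.relations) (Hthick : ∀ (m' : ℕ) (s : KZ.IntegralRep (B + 1 + 1)) (M : Fin m' → (Fin (B + 1) → ℚ) × ℚ) (p : MvPolynomial (Fin B) ℚ) (u v κ : (Fin (B + 1) → ℚ) × ℚ) (A : ℚ), Bornology.IsBounded s.domain → s.domain = SeparatePos.gDom B 1 m' M (fun _ => Sum.inr u) (fun _ => Sum.inr v) → EqOn s.integrand (RebasePos.glit B 1 p L e ℓ₁ ℓ₂ n₁ n₂ (fun _ => some 0)) s.domain → κ.1 (Fin.last B) = 0 → u - κ = A • (v - u) → 0 < A → (∀ z : Fin (B + 1 + 1)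 → ℝ, (∀ j, 0 < SeparatePos.affF B 1 (M j) z) → SeparatePos.affF B 1 κ z < 0 ∧ 0 < SeparatePos.affF B 1 u z ∧ SeparatePos.affF B 1 u z < SeparatePos.affF B 1 v z) → (∃ z : Fin (B + 1 + 1) → ℝ, (∀ j, 0 ≤ SeparatePos.affF B 1 (M j) z) ∧ SeparatePos.affF B 1 κ z = 0 ∧ SeparatePos.affF B 1 u z = 0 ∧ SeparatePos.affF B 1 v z = 0) → ∃ c ∈ AddSubgroup.closure (SeparatePos.GGset B 2 1), KZ.of s - c ∈ KZ.relations) (Hfar : ∀ (m' : ℕ) (s : KZ.IntegralRep (B + 1 + 1)) (M : Fin m' → (Fin (B + 1) → ℚ) × ℚ) (p : MvPolynomial (Fin B) ℚ) (u v κ : (Fin (B + 1) → ℚ) × ℚ) (A : ℚ), Bornology.IsBounded s.domain → s.domain = SeparatePos.gDom B 1 m' M (fun _ => Sum.inr u) (fun _ => Sum.inr v) → EqOn s.integrand (RebasePos.glit B 1 p L e ℓ₁ ℓ₂ n₁ n₂ (fun _ => some 0)) s.domain → κ.1 (Fin.last B) = 0 → u - κ = A • (v - u) → 0 < A → (∀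 z : Fin (B + 1 + 1) → ℝ, (∀ j, 0 < SeparatePos.affF B 1 (M j) z) → 0 < SeparatePos.affF B 1 κ z ∧ SeparatePos.affF B 1 u z < SeparatePos.affF B 1 v z ∧ 2 * SeparatePos.affF B 1 κ z ≤ SeparatePos.affF B 1 v z) → (∃ z : Fin (B + 1 + 1) → ℝ, (∀ j, 0 ≤ SeparatePos.affF B 1 (M j) z) ∧ SeparatePos.affF B 1 κ z = 0 ∧ SeparatePos.affF B 1 u z = 0 ∧ SeparatePos.affF B 1 v z = 0) → ∃ c ∈ AddSubgroup.closure (SeparatePos.GGset B 2 1), KZ.of s - c ∈ KZ.relations) : ∃ c ∈ AddSubgroup.closure (SeparatePos.GGset B 2 1), KZ.of s - c ∈ KZ.relations :=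
  RebasePos.good_oneFibre L e ℓ₁ ℓ₂ n₁ n₂ s M p a lo hi h12 hbd hdom hint
    fun _ s M p u v hbd hdom hint hu hv hcell =>
      RebasePos.good_above_of_corner L e ℓ₁ ℓ₂ n₁ n₂ s M p u v h12 hbd hdom hint hu hv hcell Hpar Hthick Hfar

/-- **The registered part `rebaseSimplePos_oneFibre` of `stub_rebaseSimplePos` (= the stub
`stub_rebaseSimplePosOne` with the narrow target `GG (b+1) 2 1`) from parallel bands and corner
bands** (exactly its signature plus `Hpar`, and `Hthick`, `Hfar` restricted to base cells whose
closed cell contains a corner point, at `B = b + 1`, `n₁ = 0`, `n₂ = 1`):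
`GS (b+1) 1 → closure (GG (b+1) 2 1)` modulo `KZ.relations`. -/
theorem rebaseSimplePos_oneFibre_of_corner' (GS : ℕ → ℕ → Set KZ.FormalRep) (GG : ℕ → ℕ → ℕ → Set KZ.FormalRep) (hGS : ∀ b k, GS b k = {w : KZ.FormalRep | ∃ (m m' n₁ n₂ : ℕ) (s : KZ.IntegralRep (b + 1 + k)) (M : Fin m' → (Fin (b + 1) → ℚ) × ℚ) (L : Fin m → (Fin b → ℚ) × ℚ) (e : Fin m → ℕ) (p : MvPolynomial (Fin b) ℚ) (ℓ₁ ℓ₂ : (Fin b → ℚ) × ℚ) (a : Fin k → Option ((Fin (b + 1) → ℚ) × ℚ)) (lo hi : Fin k → Fin k ⊕ ((Fin (b + 1) → ℚ) × ℚ)), (n₁ = 0 ∨ n₂ = 0) ∧ n₂ = 1 ∧ Bornology.IsBounded s.domain ∧ s.domain = {z | (∀ j, 0 < ∑ i, ((M j).1 i : ℝ) * z (Fin.castAdd k i) + ((M j).2 : ℝ)) ∧ ∀ i, Sum.elim (fun j => z (Fin.natAdd (b + 1) j)) (fun c => ∑ i', (c.1 i' : ℝ) * z (Fin.castAdd k i')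 + (c.2 : ℝ)) (lo i) < z (Fin.natAdd (b + 1) i) ∧ z (Fin.natAdd (b + 1) i) < Sum.elim (fun j => z (Fin.natAdd (b + 1) j)) (fun c => ∑ i', (c.1 i' : ℝ) * z (Fin.castAdd k i') + (c.2 : ℝ)) (hi i)} ∧ EqOn s.integrand (fun z => MvPolynomial.aeval (fun i => z (Fin.castAdd k (Fin.castSucc i))) p / (∏ j, (∑ i, ((L j).1 i : ℝ) * z (Fin.castAdd k (Fin.castSucc i)) + ((L j).2 : ℝ)) ^ e j) * ((z (Fin.castAdd k (Fin.last b)) - (∑ i, (ℓ₁.1 i : ℝ) * z (Fin.castAdd k (Fin.castSucc i)) + (ℓ₁.2 : ℝ))) ^ n₁ / (z (Fin.castAdd k (Fin.last b)) - (∑ i, (ℓ₂.1 i : ℝ) * z (Fin.castAdd k (Fin.castSucc i)) + (ℓ₂.2 : ℝ))) ^ n₂) * ∏ i, (a i).elim 1 (fun c => 1 / (z (Fin.natAdd (b + 1) i) - (∑ i', (c.1 i' : ℝ) * z (Fin.castAdd k i') + (c.2 : ℝ))))) s.domain ∧ w = KZ.of s}) (hGG : ∀ b σ k, GG b σ k =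 {w : KZ.FormalRep | ∃ (m m' n₁ n₂ : ℕ) (s : KZ.IntegralRep (b + 1 + k)) (M : Fin m' → (Fin (b + 1) → ℚ) × ℚ) (L : Fin m → (Fin b → ℚ) × ℚ) (e : Fin m → ℕ) (p : MvPolynomial (Fin b) ℚ) (ℓ₁ ℓ₂ : (Fin b → ℚ) × ℚ) (a : Fin k → Option ((Fin (b + 1) → ℚ) × ℚ)) (lo hi : Fin k → Fin k ⊕ ((Fin (b + 1) → ℚ) × ℚ)), (n₁ = 0 ∨ n₂ = 0) ∧ (σ = 2 → (∀ i c, a i = some c → c.1 (Fin.last b) = 0) ∧ (∀ i c, (lo i = Sum.inr c ∨ hi i = Sum.inr c) → (c.1 (Fin.last b) = 0 ∨ c = (Pi.single (Fin.last b) 1, 0)))) ∧ Bornology.IsBounded s.domain ∧ s.domain = {z | (∀ j, 0 < ∑ i, ((M j).1 i : ℝ) * z (Fin.castAdd k i) + ((M j).2 : ℝ)) ∧ ∀ i, Sum.elim (fun j => z (Fin.natAdd (b + 1) j)) (fun c => ∑ i', (c.1 i' : ℝ) * z (Fin.castAdd k i') + (c.2 : ℝ)) (lo i) < z (Fin.natAdd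 (b + 1) i) ∧ z (Fin.natAdd (b + 1) i) < Sum.elim (fun j => z (Fin.natAdd (b + 1) j)) (fun c => ∑ i', (c.1 i' : ℝ) * z (Fin.castAdd k i') + (c.2 : ℝ)) (hi i)} ∧ EqOn s.integrand (fun z => MvPolynomial.aeval (fun i => z (Fin.castAdd k (Fin.castSucc i))) p / (∏ j, (∑ i, ((L j).1 i : ℝ) * z (Fin.castAdd k (Fin.castSucc i)) + ((L j).2 : ℝ)) ^ e j) * ((z (Fin.castAdd k (Fin.last b)) - (∑ i, (ℓ₁.1 i : ℝ) * z (Fin.castAdd k (Fin.castSucc i)) + (ℓ₁.2 : ℝ))) ^ n₁ / (z (Fin.castAdd k (Fin.last b)) - (∑ i, (ℓ₂.1 i : ℝ) * z (Fin.castAdd k (Fin.castSucc i)) + (ℓ₂.2 : ℝ))) ^ n₂) * ∏ i, (a i).elim 1 (fun c => 1 / (z (Fin.natAdd (b + 1) i) - (∑ i', (c.1 i' : ℝ) * z (Fin.castAdd k i') + (c.2 : ℝ))))) s.domain ∧ w = KZ.of s}) (b : ℕ) (Hpar : ∀ (m : ℕ) (L : Fin m → (Fin (b + 1) → ℚ)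 × ℚ) (e : Fin m → ℕ) (ℓ₁ ℓ₂ : (Fin (b + 1) → ℚ) × ℚ), ∀ (m' : ℕ) (s : KZ.IntegralRep (b + 1 + 1 + 1)) (M : Fin m' → (Fin (b + 1 + 1) → ℚ) × ℚ) (p : MvPolynomial (Fin (b + 1)) ℚ) (u v : (Fin (b + 1 + 1) → ℚ) × ℚ), Bornology.IsBounded s.domain → s.domain = SeparatePos.gDom (b + 1) 1 m' M (fun _ => Sum.inr u) (fun _ => Sum.inr v) → EqOn s.integrand (RebasePos.glit (b + 1) 1 p L e ℓ₁ ℓ₂ 0 1 (fun _ => some 0)) s.domain → u.1 (Fin.last (b + 1)) ≠ 0 → u.1 (Fin.last (b + 1)) = v.1 (Fin.last (b + 1)) → (∀ z : Fin (b + 1 + 1 + 1) → ℝ, (∀ j, 0 < SeparatePos.affF (b + 1) 1 (M j) z) → 0 < SeparatePos.affF (b + 1) 1 u z ∧ SeparatePos.affF (b + 1) 1 u z < SeparatePos.affF (b + 1) 1 v z) → ∃ c ∈ AddSubgroup.closure (SeparatePos.GGset (b + 1) 2 1), KZ.of s - c ∈ KZ.relations) (Hthick : ∀ (m : ℕ)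 (L : Fin m → (Fin (b + 1) → ℚ) × ℚ) (e : Fin m → ℕ) (ℓ₁ ℓ₂ : (Fin (b + 1) → ℚ) × ℚ), ∀ (m' : ℕ) (s : KZ.IntegralRep (b + 1 + 1 + 1)) (M : Fin m' → (Fin (b + 1 + 1) → ℚ) × ℚ) (p : MvPolynomial (Fin (b + 1)) ℚ) (u v κ : (Fin (b + 1 + 1) → ℚ) × ℚ) (A : ℚ), Bornology.IsBounded s.domain → s.domain = SeparatePos.gDom (b + 1) 1 m' M (fun _ => Sum.inr u) (fun _ => Sum.inr v) → EqOn s.integrand (RebasePos.glit (b + 1) 1 p L e ℓ₁ ℓ₂ 0 1 (fun _ => some 0)) s.domain → κ.1 (Fin.last (b + 1)) = 0 → u - κ = A • (v - u) → 0 < A → (∀ z : Fin (b + 1 + 1 + 1) → ℝ, (∀ j, 0 < SeparatePos.affF (b + 1) 1 (M j) z) → SeparatePos.affF (b + 1) 1 κ z < 0 ∧ 0 < SeparatePos.affF (b + 1) 1 u z ∧ SeparatePos.affF (b + 1) 1 u z < SeparatePos.affF (b + 1) 1 v z) → (∃ z : Fin (b + 1 + 1 + 1) → ℝ, (∀ j,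 0 ≤ SeparatePos.affF (b + 1) 1 (M j) z) ∧ SeparatePos.affF (b + 1) 1 κ z = 0 ∧ SeparatePos.affF (b + 1) 1 u z = 0 ∧ SeparatePos.affF (b + 1) 1 v z = 0) → ∃ c ∈ AddSubgroup.closure (SeparatePos.GGset (b + 1) 2 1), KZ.of s - c ∈ KZ.relations) (Hfar : ∀ (m : ℕ) (L : Fin m → (Fin (b + 1) → ℚ) × ℚ) (e : Fin m → ℕ) (ℓ₁ ℓ₂ : (Fin (b + 1) → ℚ) × ℚ), ∀ (m' : ℕ) (s : KZ.IntegralRep (b + 1 + 1 + 1)) (M : Fin m' → (Fin (b + 1 + 1) → ℚ) × ℚ) (p : MvPolynomial (Fin (b + 1)) ℚ) (u v κ : (Fin (b + 1 + 1) → ℚ) × ℚ) (A : ℚ), Bornology.IsBounded s.domain → s.domain = SeparatePos.gDom (b + 1) 1 m' M (fun _ => Sum.inr u) (fun _ => Sum.inr v) → EqOn s.integrand (RebasePos.glit (b + 1) 1 p L e ℓ₁ ℓ₂ 0 1 (fun _ => some 0)) s.domain → κ.1 (Fin.last (b + 1)) = 0 → u - κ = A • (v - u) → 0 < A → (∀ z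 : Fin (b + 1 + 1 + 1) → ℝ, (∀ j, 0 < SeparatePos.affF (b + 1) 1 (M j) z) → 0 < SeparatePos.affF (b + 1) 1 κ z ∧ SeparatePos.affF (b + 1) 1 u z < SeparatePos.affF (b + 1) 1 v z ∧ 2 * SeparatePos.affF (b + 1) 1 κ z ≤ SeparatePos.affF (b + 1) 1 v z) → (∃ z : Fin (b + 1 + 1 + 1) → ℝ, (∀ j, 0 ≤ SeparatePos.affF (b + 1) 1 (M j) z) ∧ SeparatePos.affF (b + 1) 1 κ z = 0 ∧ SeparatePos.affF (b + 1) 1 u z = 0 ∧ SeparatePos.affF (b + 1) 1 v z = 0) → ∃ c ∈ AddSubgroup.closure (SeparatePos.GGset (b + 1) 2 1), KZ.of s - c ∈ KZ.relations) : ∀ x ∈ GS (b + 1) 1, ∃ c ∈ AddSubgroup.closure (GG (b + 1) 2 1), x - c ∈ KZ.relations := by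
  intro x hx
  rw [hGS] at hx
  obtain ⟨m, m', n₁, n₂, s, M, L, e, p, ℓ₁, ℓ₂, a, lo, hi, h12, hn₂, hbd, hdom, hint, rfl⟩ := hx
  obtain rfl : n₁ = 0 := h12.resolve_right (by rw [hn₂]; exact one_ne_zero)
  subst hn₂
  rw [hGG]
  exact rebaseSimplePos_oneFibre_of_corner (b + 1) m m' 0 1 s M L e p ℓ₁ ℓ₂ a lo hi (Or.inl rfl) hbd
    hdom hint (Hpar m L e ℓ₁ ℓ₂) (Hthick m L e ℓ₁ ℓ₂) (Hfar m L e ℓ₁ ℓ₂)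



end Summit.KontsevichZagierPeriods.ArrangementNormalForm.JanusBands
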